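import Literature.Topology.FourManifolds.HCobordismMiddleLevelHolds
import HarnessLib

/-!
# Wall 1964, Theorem 3 — discharge of `exists_isStabilization_of_isHCobordant`

Topic `Literature/Topology/FourManifolds`; sibling proof file of `WallStabilisation.lean` (which
states the named fact `Literature.Topology.FourManifolds.exists_isStabilization_of_isHCobordant`;
the discharge cannot be appended there because the middle-level files import it).

C. T. C. Wall, *On simply-connected 4-manifolds*, J. London Math. Soc. 39 (1964) 141–149,
Thm. 3 (p. 146): *"If `M₁`, `M₂` are h-cobordant simply-connected 4-manifolds, then for some
`k`, `M₁ # k(S² × S²) ≅ M₂ # k(S² × S²)`."*  Wall's proof (pp. 146–147; = Kirby 1989, Ch. X,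
proof of Thm. 1 and Thm. 3, pp. 55–56) takes a nice Morse function on the h-cobordism with
2- and 3-handles only and observes that its level `2½` is diffeomorphic both to
`M₁ # k(S² × S²)` and to `M₂ # k(S² × S²)`.  That middle-level statement is the tree's fact
`Literature.Topology.FourManifolds.exists_middleLevel_isStabilization_of_isHCobordism`
(`HCobordismMiddleLevel.lean`), now a theorem
(`exists_middleLevel_isStabilization_of_isHCobordism_holds`, `HCobordismMiddleLevelHolds.lean`,
along Kirby's pp. 55–56: handle trading, Milnor Thm. 3.13 at the critical levels, isotopy of the
attaching circles to chart circles, the two framings, and the even/odd elimination of the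
twisted surgery); forgetting the Morse function and the middle level is the tree's glue
`exists_isStabilization_of_isHCobordant_of_middleLevel` (`HCobordismMiddleLevel.lean`).  The
discharge below is their composition — no definitions, no named facts.

## References

* C. T. C. Wall, *On simply-connected 4-manifolds*, J. London Math. Soc. 39 (1964) 141–149,
  Thm. 3 (p. 146) and its proof (pp. 146–147). [WallJLMS1964] [Wall1964]
* R. C. Kirby, *The topology of 4-manifolds*, Lecture Notes in Math. 1374, Springer (1989),
  Ch. X, Thm. 3 (p. 56) and proof of Thm. 1 (pp. 55–56). [Kirby1989]
-/

namespace Literature.Topology.FourManifolds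

/-- **Wall 1964, Thm. 3 (discharged).**  H-cobordant simply connected closed smooth
4-manifolds become diffeomorphic after connected sum with the same number of copies of
`S² × S²`: the common stabilisation is the middle level of a 2/3-handle Morse function on the
h-cobordism (`exists_middleLevel_isStabilization_of_isHCobordism_holds`), and forgetting that
level is `exists_isStabilization_of_isHCobordant_of_middleLevel`.
[cite: WallJLMS1964, Thm. 3 (p. 146), proof pp. 146–147] [cite: Kirby1989, Ch. X, Thm. 3 (p. 56), proof of Thm. 1 pp. 55–56] -/
theorem exists_isStabilization_of_isHCobordant_holds : exists_isStabilization_of_isHCobordant :=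
  exists_isStabilization_of_isHCobordant_of_middleLevel
    exists_middleLevel_isStabilization_of_isHCobordism_holds

end Literature.Topology.FourManifolds
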